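import Literature.Barriers.NavierStokesRegularity.AbstractAPrioriEstimateDirectSum
import Literature.Barriers.NavierStokesRegularity.AbstractAPrioriEstimateDirectSumBlocks
import HarnessLib

/-!
# Barrier `AbstractAPrioriEstimateDirectSum` — the 2-block construction, part 2 ((У.5), witness, discharge)

Part 2 of the construction behind the catalogue entry
`Literature.Barriers.NavierStokesRegularity.AbstractAPrioriEstimateDirectSum` (part 1 =
`AbstractAPrioriEstimateDirectSumBlocks.lean`: the instance `S53 n` in `ℝ⁵³` and (У.1)–(У.4)). Here:
(У.5) holds with `L_P ≡ 0` for every `n' ≥ 0`, `C_P > 0`; the witness `ů = −n(e₅₁+e₅₂)` has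
`A^{-1}ů = −½e₅₁ − (n/(2n+1))e₅₂` of norm `≤ 1`, `ů + L(ů,ů) = 0`, `‖ů‖ = n√2`; choosing `n = max m 26` with
`m > 2|C₁|` beats any offered `(C₁, l)` [cite: DxdyTopic80156, post 817605 (2014-01-21)]. Everything PROVED.

* `S53_y5`, `weakEstimate_uWit`, `nl_uWit`, `norm_uWit`, `violation`;
* `abstractAPrioriEstimateDirectSum_holds` — discharge of the entry;
* `not_otelbaev2013_theorem61`, `not_otelbaev2013_theorem62` — unconditional Literature-side corollaries
  (the cell's verdict theorems are refuter-1's Summits-side `…Theorems.Otelbaev2013.not_Theorem61/62`).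

WHAT THIS IS NOT: not a claim about NS regularity or blow-up; not a claim about any author beyond the
typed locator.
-/

noncomputable section
open scoped RealInnerProductSpace
open Literature.Claims.NS.Otelbaev2013 Set Function

namespace Literature.Barriers.NavierStokesRegularity

namespace AbstractAPrioriEstimateDirectSum

variable (n : ℕ)

/-! ### (У.5) -/

/-- Block computation `proj_coord` for sup's 2014 family (one-block truncation in `ℝ⁵³`). [cite: DxdyTopic80156, post 817605 (2014-01-21)] -/
theorem proj_coord {P : H53 →ₗ[ℝ] H53} (hP : (S53 n).IsProjG1 P) (u : H53) (i : Fin 53) :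
    (P u) i = if eig53 n i = 1 then u i else 0 := by
  have := hP u i
  simpa [basis_inner, eig_def] using this

/-- Block computation `proj_coord_51` for sup's 2014 family (one-block truncation in `ℝ⁵³`). [cite: DxdyTopic80156, post 817605 (2014-01-21)] -/
theorem proj_coord_51 (hn : 1 ≤ n) {P : H53 →ₗ[ℝ] H53} (hP : (S53 n).IsProjG1 P) (u : H53) :
    (P u) 51 = 0 := by
  rw [proj_coord n hP]
  have : eig53 n 51 ≠ 1 := by
    rw [eig_51]; have hn' : (1 : ℝ) ≤ n := by exact_mod_cast hn
    linarith
  simp [this]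

/-- Block computation `proj_coord_52` for sup's 2014 family (one-block truncation in `ℝ⁵³`). [cite: DxdyTopic80156, post 817605 (2014-01-21)] -/
theorem proj_coord_52 (hn : 1 ≤ n) {P : H53 →ₗ[ℝ] H53} (hP : (S53 n).IsProjG1 P) (u : H53) :
    (P u) 52 = 0 := by
  rw [proj_coord n hP]
  have : eig53 n 52 ≠ 1 := by
    rw [eig_52]; have hn' : (1 : ℝ) ≤ n := by exact_mod_cast hn
    linarith
  simp [this]

/-- Block computation `proj_L_eq_zero` for sup's 2014 family (one-block truncation in `ℝ⁵³`). [cite: DxdyTopic80156, post 817605 (2014-01-21)] -/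
theorem proj_L_eq_zero (hn : 1 ≤ n) {P : H53 →ₗ[ℝ] H53} (hP : (S53 n).IsProjG1 P) (u v : H53) :
    P ((S53 n).L u v) = 0 := by
  rw [L_apply, map_smul]
  suffices h : P (e51 + e52) = 0 by rw [h, smul_zero]
  ext i
  rw [proj_coord n hP, PiLp.zero_apply]
  by_cases h : eig53 n i = 1
  · have hi : i.val < 50 := (eig_eq_one_iff n hn i).1 h
    have h51 : i ≠ 51 := fun h' => by subst h'; simp at hi
    have h52 : i ≠ 52 := fun h' => by subst h'; simp at hi
    simp [h, h51, h52]
  · simp [h]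

/-- Block computation `LP_eq_zero` for sup's 2014 family (one-block truncation in `ℝ⁵³`). [cite: DxdyTopic80156, post 817605 (2014-01-21)] -/
theorem LP_eq_zero (hn : 1 ≤ n) {P : H53 →ₗ[ℝ] H53} (hP : (S53 n).IsProjG1 P) (u : H53) :
    (S53 n).LP P u u = 0 := by
  have h1 : (S53 n).L (P u) u = 0 := L_eq_zero_of_left n (proj_coord_51 n hn hP u) u
  have h2 : (S53 n).L u (P u) = 0 := L_eq_zero_of_right n u (proj_coord_52 n hn hP u)
  have h3 : (S53 n).L (P u) (P u) = 0 := L_eq_zero_of_left n (proj_coord_51 n hn hP u) (P u)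
  simp [Setting.LP, h1, h2, h3, proj_L_eq_zero n hn hP]

/-- Block computation `S53_y5` for sup's 2014 family (one-block truncation in `ℝ⁵³`). [cite: DxdyTopic80156, post 817605 (2014-01-21)] -/
theorem S53_y5 (hn : 1 ≤ n) {n' CP : ℝ} (hn' : 0 ≤ n') (hCP : 0 < CP) : (S53 n).Y5 n' CP := by
  refine ⟨hn', hCP, fun P hP u => ?_⟩
  rw [LP_eq_zero n hn hP, norm_zero]
  have : 0 ≤ ‖(S53 n).nl u‖ ^ n' := Real.rpow_nonneg (norm_nonneg _) _
  positivity

/-! ### the witness -/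

/-- The witness `ů = −n(e₅₁ + e₅₂)` (an exact zero of `u ↦ u + L(u,u)`, norm `n√2`). [folklore] -/
def uWit (n : ℕ) : H53 := (-(n : ℝ)) • (e51 + e52)

/-- Block computation `uWit_51` for sup's 2014 family (one-block truncation in `ℝ⁵³`). [cite: DxdyTopic80156, post 817605 (2014-01-21)] -/
theorem uWit_51 : uWit n 51 = -(n : ℝ) := by
  simp [uWit, show ((51 : Fin 53) = 52) = False by decide]

/-- Block computation `uWit_52` for sup's 2014 family (one-block truncation in `ℝ⁵³`). [cite: DxdyTopic80156, post 817605 (2014-01-21)] -/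
theorem uWit_52 : uWit n 52 = -(n : ℝ) := by
  simp [uWit, show ((52 : Fin 53) = 51) = False by decide]

/-- Block computation `uWit_other` for sup's 2014 family (one-block truncation in `ℝ⁵³`). [cite: DxdyTopic80156, post 817605 (2014-01-21)] -/
theorem uWit_other {i : Fin 53} (h51 : i ≠ 51) (h52 : i ≠ 52) : uWit n i = 0 := by
  simp [uWit, h51, h52]

/-- Block computation `nl_uWit` for sup's 2014 family (one-block truncation in `ℝ⁵³`). [cite: DxdyTopic80156, post 817605 (2014-01-21)] -/
theorem nl_uWit (hn : 1 ≤ n) : (S53 n).nl (uWit n) = 0 := by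
  have hn0 : (n : ℝ) ≠ 0 := by exact_mod_cast (Nat.one_le_iff_ne_zero.1 hn)
  rw [Setting.nl, L_apply, uWit_51, uWit_52, uWit]
  rw [← add_smul]
  have : (-(n : ℝ)) + (-(n : ℝ)) * (-(n : ℝ)) / n = 0 := by field_simp; ring
  rw [this, zero_smul]

/-- Block computation `norm_uWit` for sup's 2014 family (one-block truncation in `ℝ⁵³`). [cite: DxdyTopic80156, post 817605 (2014-01-21)] -/
theorem norm_uWit : ‖uWit n‖ = n * Real.sqrt 2 := by
  rw [uWit, norm_smul, norm_e51_add_e52, norm_neg, Real.norm_eq_abs, Nat.abs_cast]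

/-- The weak vector `A^{-1}ů = −½ e₅₁ − (n/(2n+1)) e₅₂` (norm `≤ 1`). [folklore] -/
def wWit (n : ℕ) : H53 := (-(1 / 2 : ℝ)) • e51 + (-(n : ℝ) / (2 * n + 1)) • e52

/-- Block computation `wWit_51` for sup's 2014 family (one-block truncation in `ℝ⁵³`). [cite: DxdyTopic80156, post 817605 (2014-01-21)] -/
theorem wWit_51 : wWit n 51 = -(1 / 2 : ℝ) := by
  simp [wWit, show ((51 : Fin 53) = 52) = False by decide]

/-- Block computation `wWit_52` for sup's 2014 family (one-block truncation in `ℝ⁵³`). [cite: DxdyTopic80156, post 817605 (2014-01-21)] -/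
theorem wWit_52 : wWit n 52 = -(n : ℝ) / (2 * n + 1) := by
  simp [wWit, show ((52 : Fin 53) = 51) = False by decide]

/-- Block computation `wWit_other` for sup's 2014 family (one-block truncation in `ℝ⁵³`). [cite: DxdyTopic80156, post 817605 (2014-01-21)] -/
theorem wWit_other {i : Fin 53} (h51 : i ≠ 51) (h52 : i ≠ 52) : wWit n i = 0 := by
  simp [wWit, h51, h52]

/-- Block computation `weakEstimate_uWit` for sup's 2014 family (one-block truncation in `ℝ⁵³`). [cite: DxdyTopic80156, post 817605 (2014-01-21)] -/
theorem weakEstimate_uWit (hn : 1 ≤ n) : (S53 n).WeakEstimate (-1) 1 (uWit n) := by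
  have hnpos : (0 : ℝ) < n := by exact_mod_cast hn
  refine ⟨wWit n, ?_, ?_⟩
  · rw [isPow_iff]
    intro i
    rw [Real.rpow_neg_one]
    by_cases h51 : i = 51
    · subst h51
      rw [eig_51, wWit_51, uWit_51]
      field_simp
    by_cases h52 : i = 52
    · subst h52
      rw [eig_52, wWit_52, uWit_52]
      field_simp
    · rw [wWit_other n h51 h52, uWit_other n h51 h52, mul_zero]
  · -- ‖w‖² = 1/4 + n²/(2n+1)² ≤ 1/2
    have hsq : ‖wWit n‖ ^ 2 ≤ 1 := by
      rw [EuclideanSpace.real_norm_sq_eq]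
      have hsplit := Finset.sum_eq_add_of_mem (51 : Fin 53) (52 : Fin 53) (Finset.mem_univ _)
        (Finset.mem_univ _) (by decide) (f := fun j => (wWit n j) ^ 2) (s := Finset.univ)
        (fun c _ hc => by rw [wWit_other n hc.1 hc.2]; simp)
      rw [hsplit, wWit_51, wWit_52, div_pow]
      have h2n1 : (0 : ℝ) < 2 * n + 1 := by positivity
      have hfrac : (-(n : ℝ)) ^ 2 / (2 * n + 1) ^ 2 ≤ 1 / 4 := by
        rw [neg_sq, div_le_div_iff₀ (by positivity) (by norm_num)]
        nlinarith
      have hq : (-(1 / 2 : ℝ)) ^ 2 = 1 / 4 := by norm_num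
      rw [hq]
      linarith
    nlinarith [norm_nonneg (wWit n)]

/-! ### assembly -/

/-- Block computation `violation` for sup's 2014 family (one-block truncation in `ℝ⁵³`). [cite: DxdyTopic80156, post 817605 (2014-01-21)] -/
theorem violation (C₁ l : ℝ) :
    ∃ S : Setting (Fin 53) (EuclideanSpace ℝ (Fin 53)),
      S.Y1 (-1 / 2) 4 ∧ S.Y2 ∧ S.Y3 ∧ S.Y4 ∧ (∀ n CP : ℝ, 0 ≤ n → 0 < CP → S.Y5 n CP) ∧
        ∃ u : EuclideanSpace ℝ (Fin 53),
          S.WeakEstimate (-1) 1 u ∧ S.nl u = 0 ∧ C₁ * (1 + ‖S.nl u‖ + ‖S.nl u‖ ^ l) < ‖u‖ := by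
  -- choose n ≥ 26 with n > 2|C₁|
  obtain ⟨m, hm⟩ := exists_nat_gt (2 * |C₁|)
  set n : ℕ := max m 26 with hn
  have hn26 : 26 ≤ n := le_max_right _ _
  have hn1 : 1 ≤ n := le_trans (by norm_num) hn26
  have hnC : 2 * |C₁| < n := lt_of_lt_of_le hm (by exact_mod_cast le_max_left m 26)
  refine ⟨S53 n, S53_y1 n hn1, S53_y2 n, S53_y3 n hn26, S53_y4 n hn1,
    fun n' CP hn' hCP => S53_y5 n hn1 hn' hCP, uWit n, weakEstimate_uWit n hn1, nl_uWit n hn1, ?_⟩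
  rw [nl_uWit n hn1, norm_zero, norm_uWit]
  have h0l : (0 : ℝ) ^ l ≤ 1 := by
    rcases eq_or_ne l 0 with h | h
    · rw [h, Real.rpow_zero]
    · rw [Real.zero_rpow h]; norm_num
  have h0l' : 0 ≤ (0 : ℝ) ^ l := Real.rpow_nonneg le_rfl _
  have hs2 : 1 ≤ Real.sqrt 2 := by
    rw [show (1 : ℝ) = Real.sqrt 1 by simp]; exact Real.sqrt_le_sqrt (by norm_num)
  have hnpos : (0 : ℝ) < n := by exact_mod_cast hn1
  calc C₁ * (1 + 0 + (0 : ℝ) ^ l) ≤ |C₁| * 2 := by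
        have : 1 + 0 + (0 : ℝ) ^ l ≤ 2 := by linarith
        calc C₁ * (1 + 0 + (0 : ℝ) ^ l) ≤ |C₁| * (1 + 0 + (0 : ℝ) ^ l) :=
              mul_le_mul_of_nonneg_right (le_abs_self _) (by linarith)
          _ ≤ |C₁| * 2 := mul_le_mul_of_nonneg_left this (abs_nonneg _)
    _ < n := by linarith
    _ ≤ n * Real.sqrt 2 := le_mul_of_one_le_right hnpos.le hs2


end AbstractAPrioriEstimateDirectSum

open AbstractAPrioriEstimateDirectSum in
/-- **Discharge of the catalogue entry** `AbstractAPrioriEstimateDirectSum`: for every `(C₁, l)` the block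
`S53 n` with `n = max m 26`, `m > 2|C₁|`, and the witness `uWit n`. [cite: DxdyTopic80156, post 817605 (2014-01-21)] -/
theorem abstractAPrioriEstimateDirectSum_holds : AbstractAPrioriEstimateDirectSum :=
  fun C₁ l => violation C₁ l

/-- Otelbaev 2013, Theorem 6.1 (p. 29) as printed (constants uniform in the space) is false — Literature-side,
unconditional. [cite: DxdyTopic80156, post 817605 (2014-01-21)] -/
theorem not_otelbaev2013_theorem61 : ¬ Theorem61 :=
  AbstractAPrioriEstimateDirectSum.not_theorem61 abstractAPrioriEstimateDirectSum_holds

/-- Otelbaev 2013, Theorem 6.2 (p. 72) as printed — the statement §7 consumes — is false (Literature-side,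
unconditional; the block has `L_P ≡ 0`). [cite: DxdyTopic80156, post 817605 (2014-01-21)] -/
theorem not_otelbaev2013_theorem62 : ¬ Theorem62 :=
  AbstractAPrioriEstimateDirectSum.not_theorem62 abstractAPrioriEstimateDirectSum_holds

end Literature.Barriers.NavierStokesRegularity

end
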